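import Summits.KontsevichZagierPeriods.Zeta5Search.LaiSweepShard

/-!
# `κ₃` sweep certificate — shard file 121 of 127 (shards 847–853 of 889)

HONEST FRAMING. Systematic search; no irrationality claim unless certified. This file only checks,
by `decide +kernel`, shards 847–853 of the order-cell sweep of the `κ₃` point `(74, 2180, 444; δ74)`
(engine `LaiSweepEngine`, soundness `LaiSweepJump/Free/Eval/Shard/Kappa3`; a shard is `⟨regime, n,
p, q, p', q', Lo, Up⟩`: `n` cells from `p/q` to `p'/q'` with integer rate sums in `[Lo, Up]`, `K =
128`, `D = 2^40`). It draws NO conclusion: only the capstone `LaiKappa3SweepCert`, which needs all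
127 shard files, does. Kernel cost of this file ≈ 560 cells × 0.3 s.
-/

namespace Summit.KontsevichZagierPeriods.Zeta5Search.Sweep

set_option maxHeartbeats 100000000 in
/-- Shard 847: 80 cells of regime B from `181/191` to `223/235`.
[cite: Lai2024BallRivoal, §4 Lemma 4.3] -/
theorem shard847 :
    Shard.check 128 (2^40)
      ⟨true, 80, 181, 191, 223, 235, 10474601218992, 18408854864734⟩ = true := by
  decide +kernel

set_option maxHeartbeats 100000000 in
/-- Shard 848: 80 cells of regime B from `223/235` to `210/221`.
[cite: Lai2024BallRivoal, §4 Lemma 4.3] -/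
theorem shard848 :
    Shard.check 128 (2^40)
      ⟨true, 80, 223, 235, 210, 221, 10453306571544, 18390797123822⟩ = true := by
  decide +kernel

set_option maxHeartbeats 100000000 in
/-- Shard 849: 80 cells of regime B from `210/221` to `255/268`.
[cite: Lai2024BallRivoal, §4 Lemma 4.3] -/
theorem shard849 :
    Shard.check 128 (2^40)
      ⟨true, 80, 210, 221, 255, 268, 10252440589918, 18056123581949⟩ = true := by
  decide +kernel

set_option maxHeartbeats 100000000 in
/-- Shard 850: 80 cells of regime B from `255/268` to `4577/4804`.
[cite: Lai2024BallRivoal, §4 Lemma 4.3] -/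
theorem shard850 :
    Shard.check 128 (2^40)
      ⟨true, 80, 255, 268, 4577, 4804, 10156094872358, 17904840009556⟩ = true := by
  decide +kernel

set_option maxHeartbeats 100000000 in
/-- Shard 851: 80 cells of regime B from `4577/4804` to `311/326`.
[cite: Lai2024BallRivoal, §4 Lemma 4.3] -/
theorem shard851 :
    Shard.check 128 (2^40)
      ⟨true, 80, 4577, 4804, 311, 326, 10027051812009, 17695237029166⟩ = true := by
  decide +kernel

set_option maxHeartbeats 100000000 in
/-- Shard 852: 80 cells of regime B from `311/326` to `4589/4804`.
[cite: Lai2024BallRivoal, §4 Lemma 4.3] -/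
theorem shard852 :
    Shard.check 128 (2^40)
      ⟨true, 80, 311, 326, 4589, 4804, 10161375909511, 17950536874443⟩ = true := by
  decide +kernel

set_option maxHeartbeats 100000000 in
/-- Shard 853: 80 cells of regime B from `4589/4804` to `329/344`.
[cite: Lai2024BallRivoal, §4 Lemma 4.3] -/
theorem shard853 :
    Shard.check 128 (2^40)
      ⟨true, 80, 4589, 4804, 329, 344, 9283974845235, 16416570045551⟩ = true := by
  decide +kernel

/-- The checked shards of this file, in order. [folklore] -/
def shards121 : List (CheckedShard 128 (2^40)) :=
  [⟨_, shard847⟩, ⟨_, shard848⟩, ⟨_, shard849⟩, ⟨_, shard850⟩, ⟨_, shard851⟩,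
    ⟨_, shard852⟩, ⟨_, shard853⟩]

end Summit.KontsevichZagierPeriods.Zeta5Search.Sweep
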